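import Literature.NumberTheory.EllipticCurves.KatoTwistedFiniteness
import Literature.NumberTheory.EllipticCurves.SelmerPInftyGaloisAction
import HarnessLib

/-!
# BSD family — Kato 2004, Cor. 14.3 (1) of Thm. 14.2 (2): a non-vanishing central twisted
# `L`-value kills the `χ`-part of the `p^∞`-Selmer group over `ℚ(ζ_m)`, EVERY prime `p`
# (named fact)

Topic `Literature/NumberTheory/EllipticCurves`.  ONE named fact, no proofs.

K. Kato, *`p`-adic Hodge theory and values of zeta functions of modular forms*, Astérisque 295
(2004), §14: for the newform `f` of an elliptic curve `E/ℚ`, an ARBITRARY prime `p` (fixed in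
14.1 together with `f`), `K = ℚ(ζ_m)` and a character `χ` of `Gal(K/ℚ)` with `L(f, χ, 1) ≠ 0`,
Thm. 14.2 (2) (lattice `T = T_p E ⊂ V_p(f)(1)`) gives the finiteness of the `χ`-part
`Sel(K, T_p E)^(χ)`, i.e. (Cor. 14.3 (1), p. 235) "The `χ`-part `Sel(K, A ⊗_ℚ K)^(χ)` of
`Sel(K, A ⊗_ℚ K)` is finite" for `A = E`; Cor. 14.3 (2), the finiteness of `E(K)^(χ)`, is the
tree's named fact `kato_finite_chiPart_of_twistedLValue_ne_zero` (`KatoTwistedFiniteness`), and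
the passage (1) ⇒ (2) is PROVED in the tree (`χ`-part Kummer descent,
`KatoTwistedFinitenessKummerDescentProofs`).

The statement below is Cor. 14.3 (1) for `A = E`, `K = ℚ(ζ_m)` (`m ≢ 2 (mod 4)`), at every prime
`p`, in the vocabulary of that proof: the `χ`-part is taken for the action `σ ↦ σ_*` of
`Gal(K/ℚ)` on `H¹(K, E[p^∞])` through the chosen lifts (`IsLiftOfAut.conjH1Primary` of
`liftAut σ`; lift-independent by `IsLiftOfAut.conjH1Primary_eq`), intersected with
`Sel_{p^∞}(E/K) = selmerGroupPInfty`.  It is the hypothesis `hSel` of the ACCEPTED reduction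
`kato_finite_chiPart_of_twistedLValue_ne_zero_of_selmer`
(`KatoTwistedFinitenessKummerDescentProofs.lean`, p147357) with its inner `∃ p` replaced by
`∀ p` — as printed, Kato's `p` being arbitrary — so that the reduction applies at any one prime
(e.g. `p = 2`); vendored as a named fact at the request of promote event 4558427 (18 provefact
sessions on `kato_finite_chiPart_cyclotomic_of_twistedLValue_ne_zero`; librarian sweep g40,
2026-08-17).  With it `kato_finite_chiPart_of_twistedLValue_ne_zero` is ONE line
(`…_of_selmer fun W _ _ _ _ hf _ _ hm χ hL => ⟨2, ⟨Nat.prime_two⟩, h W hf hm χ hL 2⟩`).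
Deliberately NOT here: Kato's Euler system (§§8–13, 14.6–14.22), general abelian `K`, any proof.

## References

* K. Kato, *`p`-adic Hodge theory and values of zeta functions of modular forms*, Astérisque 295
  (2004), 117–290: 14.1, Thm. 14.2 (2), Cor. 14.3 (1)(2) (p. 235). [Kato2004Asterisque]
* B. Gross, *Kolyvagin's work on modular elliptic curves*, LMS Lecture Notes 153 (1991), §5 (5.1)
  (the Galois action on `H¹`). [GrossLMS1991]
-/

noncomputable section

-- `Classical` is scoped-open exactly as in `SelmerPInftyGaloisAction` and the consumer file.
open scoped Classical

open WeierstrassCurve CongruenceSubgroup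

namespace Literature.NumberTheory.EllipticCurves

open GaloisRepresentations ModularForms

set_option backward.isDefEq.respectTransparency false in
/-- **Kato 2004, Cor. 14.3 (1) of Thm. 14.2 (2), for `E/ℚ` over `ℚ(ζ_m)`, every prime `p`.**
Let `E/ℚ` be an elliptic curve (model `W`) with newform `f ∈ S₂(Γ₀(N))` (`IsNewformOf W f`), let
`m ≥ 1` with `m ≢ 2 (mod 4)`, `K = ℚ(ζ_m)`, and let `χ` be a Dirichlet character mod `m` read on
`Gal(K/ℚ)` (`cyclotomicCharacterOf χ`).  If `L(f, χ, 1) ≠ 0` (some entire continuation `L` of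
`twistedLSeries f χ` has `L 1 ≠ 0`), then for EVERY prime `p` the `χ`-part of the `p^∞`-Selmer
group `Sel_{p^∞}(E/K) ⊂ H¹(K, E[p^∞])`, for the action `σ ↦ σ_*` of `Gal(K/ℚ)`
(`IsLiftOfAut.conjH1Primary` of the lifts `liftAut σ`), is finite.  As printed (Cor. 14.3, p. 235,
`p` the prime fixed in 14.1): "assume `L(A, χ, 1) ≠ 0`. Then: (1) The `χ`-part
`Sel(K, A ⊗_ℚ K)^(χ)` of `Sel(K, A ⊗_ℚ K)` is finite."  Here `A = E`, `K = ℚ(ζ_m)`.  Equal to the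
hypothesis `hSel` of `kato_finite_chiPart_of_twistedLValue_ne_zero_of_selmer` with `∃ p`
strengthened to the printed `∀ p`.  (The option `backward.isDefEq.respectTransparency false`
identifies the two `ℚ`-algebra structures on `CyclotomicField m ℚ`, as in `KatoTwistedFiniteness`.)
[cite: Kato2004Asterisque, Cor. 14.3 (1) with Thm. 14.2 (2) (p. 235)] -/
def kato_finite_chiPart_selmer_of_twistedLValue_ne_zero : Prop :=
  ∀ (W : WeierstrassCurve ℚ) [W.IsElliptic] {N : ℕ} [NeZero N] {f : CuspForm (Gamma0 N) 2}
    (_hf : IsNewformOf W f) {m : ℕ} [NeZero m] (_hm : m % 4 ≠ 2) (χ : DirichletCharacter ℂ m)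
    (_hL : ∃ L : ℂ → ℂ, Differentiable ℂ L ∧
      (∀ s : ℂ, 2 < s.re → L s = twistedLSeries f χ s) ∧ L 1 ≠ 0)
    (p : ℕ) [Fact p.Prime],
    Finite ↥(chiPart (fun σ : CyclotomicField m ℚ ≃ₐ[ℚ] CyclotomicField m ℚ =>
          (isLiftOfAut_liftAut σ).conjH1Primary W p)
        (fun σ => (cyclotomicCharacterOf χ σ : ℂ)) ⊓
      selmerGroupPInfty (W.baseChange (CyclotomicField m ℚ)) p)

end Literature.NumberTheory.EllipticCurves

end
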